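import Summits.Langlands.Langlands.Theses.RamifiedCoefficientSeed
import Literature.FieldTheory.AlgClosed.AutomorphismExtension
import Literature.FieldTheory.AlgClosed.PadicAlgClEquivComplex
import Literature.NumberTheory.GaloisRepresentations.GaloisRepFrobeniusProofs

/-!
# Sketch — crux-ideate round 1, ideator 1, crux stmt-Langlands-16781
(`RamifiedCoefficientSeed.SectorComplement := NonPolarisableFamilyAutomorphic → _root_.Langlands`)

First lemmas of the two idea cards of this seat.  Everything elaborates; §1's composition is PROVED
(no `sorry`), §2's matrix identities are PROVED, the statement defs of §1–§2 are signatures only.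

* §1 `reflection-seed-closure`: (B)-weak on the COMPATIBLE-SYSTEM CLOSURE of the route's adjoint-seed
  sector follows from the route's own cruxes `AdjointLiftingGL3` (16779) and `AdjointSeedFromDuality`
  (16780) BY NAME plus partner transport (the three `Transport` lemmas are VERBATIM copies of the
  landed `Theorems/EisensteinGelfandKirillovSectorComplementPartnerTransport.lean` /
  `…IrreducibleOffSectorIotaTransport.lean`, inlined only because those oleans were stale on the farm
  at check time), at EVERY `(ℓ, ι)` — the prescribed-`ι` direction is obtained by choosing the
  comparison isomorphism at the SEED prime, not at the target prime
  (`weakBOnReflectionClosureQ_of_cruxes`).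
* §2 `discriminant-parity-seed-ladder`: the tensor of two `GL₂`-valued representations preserves the
  SYMMETRIC form `J ⊗ J` with multiplier `det ⊗ det` (`kronecker_transpose_JJ`), the computation behind
  the sign law "odd ⊗ odd ⟺ μ̄(c) = +1"; signatures of the rank-4 rung `TensorSeedFromDuality4`,
  `TensorLiftingGL4`.
-/

noncomputable section

set_option linter.dupNamespace false

open scoped NumberField Classical Polynomial Matrix Kronecker
open Filter IsDedekindDomain Polynomial
open Literature.NumberTheory.Automorphic Literature.NumberTheory.GaloisRepresentations
open Summit.Langlands
open Summit.Langlands.Langlands.Theses.RamifiedCoefficientSeed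

namespace Summit.Langlands.Langlands.Cruxes.SectorComplement.Ideate16781R1K1

/-! ## §1  Reflection-seed closure -/

section Transport

/-- `∏_{a ∈ α} (X - C (ι⁻¹ a⁻¹)) = ι⁻¹(∏_{a ∈ α} (X - C a⁻¹))` coefficientwise (verbatim copy of the
landed `IrreducibleOffSector.arithFrobPolyOfSatake_one_eq_map`). [folklore] -/
theorem arithFrobPolyOfSatake_one_eq_map' {ℓ : ℕ} [Fact ℓ.Prime] (ι : PadicAlgCl ℓ ≃+* ℂ) (q : ℕ)
    (α : Multiset ℂ) :
    arithFrobPolyOfSatake ι q 1 α =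
      ((α.map fun a => X - C a⁻¹).prod).map (ι.symm : ℂ →+* PadicAlgCl ℓ) := by
  rw [arithFrobPolyOfSatake_one, Polynomial.map_multiset_prod, Multiset.map_map]
  congr 1
  refine Multiset.map_congr rfl fun a _ => ?_
  simp only [Function.comp_apply, Polynomial.map_sub, Polynomial.map_X, Polynomial.map_C,
    RingEquiv.coe_toRingHom]

/-- Reading an `E`-rational polynomial through two `ι`'s that agree on `E` (verbatim copy of the
landed `EisensteinEntry.map_eq_map_symm_of_map_eq_map_symm`). [folklore] -/
theorem map_eq_map_symm_of_map_eq_map_symm' {p ℓ : ℕ} [Fact p.Prime] [Fact ℓ.Prime]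
    (ι : PadicAlgCl p ≃+* ℂ) (ι' : PadicAlgCl ℓ ≃+* ℂ) {E : Type*} [Semiring E]
    (ep : E →+* PadicAlgCl p) (eℓ : E →+* PadicAlgCl ℓ) (hι : ∀ x : E, ι' (eℓ x) = ι (ep x))
    {P : Polynomial E} {S : Polynomial ℂ} (h : P.map ep = S.map (ι.symm : ℂ →+* PadicAlgCl p)) :
    P.map eℓ = S.map (ι'.symm : ℂ →+* PadicAlgCl ℓ) := by
  have heℓ : eℓ = (ι'.symm : ℂ →+* PadicAlgCl ℓ).comp ((ι : PadicAlgCl p →+* ℂ).comp ep) :=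
    RingHom.ext fun x => (ι'.eq_symm_apply.mpr (hι x) : eℓ x = ι'.symm (ι (ep x)))
  have hS : S = P.map ((ι : PadicAlgCl p →+* ℂ).comp ep) := by
    rw [← Polynomial.map_map, h, Polynomial.map_map, RingEquiv.comp_symm, Polynomial.map_id]
  rw [hS, heℓ, Polynomial.map_map]

/-- **Partner transport of Satake–Frobenius compatibility through a prescribed `ι'`** (verbatim copy
of the landed `EisensteinEntry.eventually_satakeFrobCompatibleAt_of_partner_of_apply_eq`; any rank,
any two primes). [cite: SerreAbelianLadic1968, Ch. I §2.3] -/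
theorem eventually_satakeFrobCompatibleAt_of_partner_of_apply_eq'
    {K : Type} [Field K] [NumberField K] {n : ℕ}
    {hcpt : isCompact_glFiniteIntegralLevel n K}
    {p ℓ : ℕ} [Fact p.Prime] [Fact ℓ.Prime] (ι : PadicAlgCl p ≃+* ℂ) (ι' : PadicAlgCl ℓ ≃+* ℂ)
    (π : AutomorphicRepData (AutomorphyDatum.gl n K hcpt))
    (ρ : FramedGaloisRep K (PadicAlgCl p) n) (ρ' : FramedGaloisRep K (PadicAlgCl ℓ) n)
    (E : Type) [Field E] (ep : E →+* PadicAlgCl p) (eℓ : E →+* PadicAlgCl ℓ)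
    (hι : ∀ x : E, ι' (eℓ x) = ι (ep x))
    (P : HeightOneSpectrum (𝓞 K) → Polynomial E)
    (hπ : ∀ᶠ v in cofinite, SatakeFrobCompatibleAt ι π ρ v)
    (hpart : ∀ᶠ v in cofinite, ρ.HasFrobCharpolyAt v ((P v).map ep) ∧ ρ'.IsUnramifiedAt v ∧
      ρ'.HasFrobCharpolyAt v ((P v).map eℓ)) :
    ∀ᶠ v in cofinite, SatakeFrobCompatibleAt ι' π ρ' v := by
  filter_upwards [hπ, hpart] with v hv hv'
  obtain ⟨α, hα, -, hcp⟩ := hv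
  obtain ⟨hPp, hur', hPℓ⟩ := hv'
  have h1 : (P v).map ep = arithFrobPolyOfSatake ι v.residueCard 1 α :=
    GaloisRep.HasFrobCharpolyAt.unique_holds
      ((FramedGaloisRep.hasFrobCharpolyAt_toGaloisRep_iff v _ ρ).mpr hPp)
      ((FramedGaloisRep.hasFrobCharpolyAt_toGaloisRep_iff v _ ρ).mpr hcp)
  rw [arithFrobPolyOfSatake_one_eq_map'] at h1
  refine ⟨α, hα, hur', ?_⟩
  rw [arithFrobPolyOfSatake_one_eq_map', ← map_eq_map_symm_of_map_eq_map_symm' ι ι' ep eℓ hι h1]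
  exact hPℓ

end Transport


/-- The route's SEED SECTOR at the prime `p`, on a `p`-adic `ρ : Γ_ℚ → GL₃(ℚ̄_p)`: verbatim the
hypotheses consumed by `AdjointLiftingGL3` and `AdjointSeedFromDuality` — `11 ≤ p`, unramified a.e.,
crystalline with labelled Hodge–Tate weights `{0,1,2}` at `p` (pinned Fontaine datum), residually
absolutely irreducible over `ℚ(ζ_p)`, RESIDUALLY POLARISED (trace form: `p` is a REFLECTION PRIME of
`ρ`) and with a complex conjugation of trace `±1`. [cite: ACCGHLNSTT2023, Thm 6.1.1] -/
def InAdjointSeedSector (p : ℕ) [Fact p.Prime] (ρ : FramedGaloisRep ℚ (PadicAlgCl p) 3) : Prop :=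
  11 ≤ p ∧
  (∀ᶠ v : HeightOneSpectrum (𝓞 ℚ) in cofinite, ρ.IsUnramifiedAt v) ∧
  (∀ (v : HeightOneSpectrum (𝓞 ℚ)) (hv : ((p : ℕ) : 𝓞 ℚ) ∈ v.asIdeal),
    let D := Literature.NumberTheory.PAdicHodge.fontainePstAdicCompletion v p hv
    D.IsCrystallineFramed (ρ.toLocal v) ∧ (letI := D.algebra;
      ∀ τ : v.adicCompletion ℚ →ₐ[ℚ_[p]] PadicAlgCl p,
        ρ.labelledHodgeTateWeightsAt v D.algebra D.𝔅 τ.toRingHom = {0, 1, 2})) ∧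
  (ρ.restrictField (CyclotomicField p ℚ)).IsResiduallyAbsIrreducible ∧
  (∃ ν : FramedGaloisRep ℚ (PadicAlgCl p) 1, ∀ σ, ‖(ρ σ).val.trace - (ν σ).val 0 0 * (ρ σ⁻¹).val.trace‖ < 1) ∧
  (∃ (φ : ℚ →+* ℝ) (c : Field.absoluteGaloisGroup ℚ), IsComplexConjugation φ c ∧
    ((ρ c).val.trace = 1 ∨ (ρ c).val.trace = -1))

/-- `ρ : Γ_ℚ → GL₃(ℚ̄_ℓ)` lies in the COMPATIBLE-SYSTEM CLOSURE of the seed sector: it has an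
`E`-rational PARTNER `ρ_p` (same Frobenius polynomials `P_v ∈ E[X]` a.e., `E` a number field with
embeddings `e_p`, `e_ℓ`) lying in the seed sector at some prime `p`.  No hypothesis on `ρ` itself
beyond the partnership (any `ℓ`, any residual image, any behaviour at `ℓ`).
[cite: SerreAbelianLadic1968, Ch. I §2.3] -/
def InReflectionClosure {ℓ : ℕ} [Fact ℓ.Prime] (ρ : FramedGaloisRep ℚ (PadicAlgCl ℓ) 3) : Prop :=
  ∃ (p : ℕ) (_ : Fact p.Prime) (ρp : FramedGaloisRep ℚ (PadicAlgCl p) 3)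
    (E : Type) (_ : Field E) (_ : NumberField E) (ep : E →+* PadicAlgCl p) (eℓ : E →+* PadicAlgCl ℓ)
    (P : HeightOneSpectrum (𝓞 ℚ) → Polynomial E),
    InAdjointSeedSector p ρp ∧
    ∀ᶠ v : HeightOneSpectrum (𝓞 ℚ) in cofinite,
      ρp.HasFrobCharpolyAt v ((P v).map ep) ∧ ρ.IsUnramifiedAt v ∧ ρ.HasFrobCharpolyAt v ((P v).map eℓ)

/-- **(B)-weak on the reflection closure, over literal `ℚ`, at EVERY `(ℓ, ι)`**: every `ℓ`-adic
`ρ` in the closure is Satake–Frobenius compatible a.e., through the GIVEN `ι`, with an L-algebraic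
cuspidal `π` on `GL₃(𝔸_ℚ)`.  [cite: BuzzardGeeLMS2014, Conj. 3.2.2] -/
def WeakBOnReflectionClosureQ : Prop :=
  ∀ (ℓ : ℕ) [Fact ℓ.Prime] (ι : PadicAlgCl ℓ ≃+* ℂ) (hcpt : isCompact_glFiniteIntegralLevel 3 ℚ)
    (ρ : FramedGaloisRep ℚ (PadicAlgCl ℓ) 3), InReflectionClosure ρ →
    ∃ π : CuspidalAutomorphicRepData 3 ℚ hcpt, π.1.IsLAlgebraic ∧
      ∀ᶠ v : HeightOneSpectrum (𝓞 ℚ) in cofinite, SatakeFrobCompatibleAt ι π.1 ρ v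

/-- **FIRST LEMMA of `reflection-seed-closure` (PROVED): the route's engine + seed cruxes give
(B)-weak on the whole reflection closure, for every prescribed `ι`.**  Given `(ℓ, ι)` and a partner
`ρ_p` in the seed sector, choose `ι_p : ℚ̄_p ≃ ℂ` agreeing with `ι` on `E` (Steinitz +
`exists_ringEquiv_apply_eq`: two embeddings of the countable `E` into `ℂ` differ by an automorphism
of `ℂ`), get `π` from `AdjointLiftingGL3` at `(p, ι_p)` — it quantifies over ALL `ι_p` — with the
odd adjoint seed supplied by `AdjointSeedFromDuality`, and transport along the partnership
(`eventually_satakeFrobCompatibleAt_of_partner_of_apply_eq`, pure polynomial algebra).  No Galois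
conjugation of `π`, no regularity of `π_∞`, no Chebotarev. [folklore] -/
theorem weakBOnReflectionClosureQ_of_cruxes (h3 : AdjointLiftingGL3) (h2 : AdjointSeedFromDuality) :
    WeakBOnReflectionClosureQ := by
  intro ℓ _ ι hcpt ρ hρ
  obtain ⟨p, hp, ρp, E, _, _, ep, eℓ, P, ⟨h11, hunr, hcrys, hirr, hdual, hcc⟩, hpart⟩ := hρ
  -- choose ι_p agreeing with ι on E
  obtain ⟨ι₀⟩ := PadicAlgCl.nonempty_ringEquiv_complex p
  have hΩ : Cardinal.aleph0 < Cardinal.mk ℂ := by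
    rw [Cardinal.mk_complex]; exact Cardinal.aleph0_lt_continuum
  haveI : Countable E := Countable.of_equiv _ (Module.finBasis ℚ E).equivFun.toEquiv.symm
  obtain ⟨σ, hσ⟩ := Literature.FieldTheory.AlgClosed.exists_ringEquiv_apply_eq hΩ
    (Cardinal.mk_le_aleph0 (α := E)) ((ι₀ : PadicAlgCl p →+* ℂ).comp ep)
    ((ι : PadicAlgCl ℓ →+* ℂ).comp eℓ)
  have hιp : ∀ x : E, ι (eℓ x) = (ι₀.trans σ) (ep x) := fun x => by
    rw [RingEquiv.trans_apply]
    exact (hσ x).symm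
  -- the engine at (p, ι_p), seeded by residual duality + parity
  obtain ⟨π, hLalg, hπ⟩ :=
    h3 p h11 ρp hunr hcrys hirr (h2 p (le_trans (by norm_num) h11) ρp hdual hirr hcc) (ι₀.trans σ) hcpt
  exact ⟨π, hLalg, eventually_satakeFrobCompatibleAt_of_partner_of_apply_eq'
    (ι₀.trans σ) ι π.1 ρp ρ E ep eℓ hιp P hπ hpart⟩

/-- The control direction: the closure contains the sector (a member is its own partner over the
prime field of `ℚ̄_p`… in the typed form: over any number field `E` through which its Frobenius
polynomials are rational).  Stated as the special case used downstream: (B)-weak on the closure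
implies (B)-weak on the sector itself at the seed prime, for partners given explicitly. [folklore] -/
theorem weakB_onSector_of_closure (h : WeakBOnReflectionClosureQ) (p : ℕ) [Fact p.Prime]
    (ι : PadicAlgCl p ≃+* ℂ) (hcpt : isCompact_glFiniteIntegralLevel 3 ℚ)
    (ρ : FramedGaloisRep ℚ (PadicAlgCl p) 3) (hρ : InAdjointSeedSector p ρ)
    (E : Type) [Field E] [NumberField E] (e : E →+* PadicAlgCl p) (P : HeightOneSpectrum (𝓞 ℚ) → Polynomial E)
    (hP : ∀ᶠ v : HeightOneSpectrum (𝓞 ℚ) in cofinite, ρ.IsUnramifiedAt v ∧ ρ.HasFrobCharpolyAt v ((P v).map e)) :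
    ∃ π : CuspidalAutomorphicRepData 3 ℚ hcpt, π.1.IsLAlgebraic ∧
      ∀ᶠ v : HeightOneSpectrum (𝓞 ℚ) in cofinite, SatakeFrobCompatibleAt ι π.1 ρ v :=
  h p ι hcpt ρ ⟨p, inferInstance, ρ, E, inferInstance, inferInstance, e, e, P, hρ,
    hP.mono fun _ hv => ⟨hv.2, hv.1, hv.2⟩⟩

/-- **REACH (signature; card K2 `ReflectionPrimesFinite`).**  For an `E`-rational family of rank-3
representations of `Γ_ℚ` indexed by primes and embeddings `e : E → ℚ̄_p` (common Frobenius
polynomials `P_v ∈ E[X]` off a finite set), crystalline with labelled weights `{0,1,2}` at all but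
finitely many members, which is NOT essentially self-dual (no member satisfies the exact trace
identity `tr ρ(σ⁻¹) = χ(σ) tr ρ(σ)`), only FINITELY many members are reflection primes (residually
polarised in the trace form).  Paper proof: the residual similitude character is `ω⁻²·ν̄` with `ν`
in a finite `λ`-independent set (determinant + inertial weights), and a congruence
`a_v ≡ ν(Frob_v) ε⁻²(Frob_v) a_v^*` holding modulo infinitely many primes is an identity in `E`,
i.e. essential self-duality. [folklore] -/
def ReflectionPrimesFinite : Prop :=
  ∀ (E : Type) [Field E] [NumberField E] (P : HeightOneSpectrum (𝓞 ℚ) → Polynomial E)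
    (ρ : ∀ (p : ℕ) (hp : Fact p.Prime), FramedGaloisRep ℚ (PadicAlgCl p) 3)
    (e : ∀ (p : ℕ) (hp : Fact p.Prime), E →+* PadicAlgCl p),
    -- an `E`-rational family: one member per prime, common Frobenius polynomials a.e.
    (∀ (p : ℕ) (hp : Fact p.Prime), ∀ᶠ v : HeightOneSpectrum (𝓞 ℚ) in cofinite,
      (ρ p hp).IsUnramifiedAt v ∧ (ρ p hp).HasFrobCharpolyAt v ((P v).map (e p hp))) →
    -- regular of labelled weights {0,1,2}: crystalline at all but finitely many members
    (∀ᶠ p : ℕ in cofinite, ∀ (hp : Fact p.Prime) (v : HeightOneSpectrum (𝓞 ℚ))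
      (hv : ((p : ℕ) : 𝓞 ℚ) ∈ v.asIdeal),
      let D := Literature.NumberTheory.PAdicHodge.fontainePstAdicCompletion v p hv
      D.IsCrystallineFramed ((ρ p hp).toLocal v) ∧ (letI := D.algebra;
        ∀ τ : v.adicCompletion ℚ →ₐ[ℚ_[p]] PadicAlgCl p,
          (ρ p hp).labelledHodgeTateWeightsAt v D.algebra D.𝔅 τ.toRingHom = {0, 1, 2})) →
    -- NOT essentially self-dual (stated member-wise; the members are partners, so one suffices on paper)
    (∀ (p : ℕ) (hp : Fact p.Prime), ¬ ∃ χ : FramedGaloisRep ℚ (PadicAlgCl p) 1,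
      ∀ σ, (ρ p hp σ⁻¹).val.trace = (χ σ).val 0 0 * (ρ p hp σ).val.trace) →
    -- conclusion: only finitely many REFLECTION PRIMES (residually polarised members, trace form)
    {p : ℕ | ∃ (hp : Fact p.Prime) (ν : FramedGaloisRep ℚ (PadicAlgCl p) 1),
      ∀ σ, ‖(ρ p hp σ).val.trace - (ν σ).val 0 0 * (ρ p hp σ⁻¹).val.trace‖ < 1}.Finite

/-! ## §2  Discriminant-parity sign law and the rank-4 tensor rung -/

section Matrices

variable {R : Type*} [CommRing R]

/-- The standard alternating form on `R²`. -/
def J2 : Matrix (Fin 2) (Fin 2) R := !![0, 1; -1, 0]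

/-- `Aᵀ J A = det A · J` for every `2 × 2` matrix: `GL₂ = GSp₂`. [folklore] -/
theorem transpose_mul_J2_mul (A : Matrix (Fin 2) (Fin 2) R) :
    Aᵀ * J2 * A = A.det • (J2 : Matrix (Fin 2) (Fin 2) R) := by
  ext i j
  fin_cases i <;> fin_cases j <;>
    simp [J2, Matrix.mul_apply, Fin.sum_univ_two, Matrix.det_fin_two] <;> ring

/-- `J ⊗ J` is SYMMETRIC (alternating ⊗ alternating = symmetric). [folklore] -/
theorem isSymm_J2_kronecker_J2 : ((J2 : Matrix (Fin 2) (Fin 2) R) ⊗ₖ (J2 : Matrix (Fin 2) (Fin 2) R)).IsSymm := by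
  unfold Matrix.IsSymm
  ext ⟨i, i'⟩ ⟨j, j'⟩
  fin_cases i <;> fin_cases i' <;> fin_cases j <;> fin_cases j' <;>
    simp [J2, Matrix.kroneckerMap_apply, Matrix.transpose_apply]

/-- **The computation behind the sign law (PROVED).**  The Kronecker product of two `2 × 2` matrices
preserves the symmetric form `J ⊗ J` with multiplier `det A · det B`:
`(A ⊗ B)ᵀ (J ⊗ J) (A ⊗ B) = (det A det B) · (J ⊗ J)`.  Hence a residual representation of the shape
`τ̄₁ ⊗ τ̄₂` is orthogonal with similitude `det τ̄₁ · det τ̄₂`, and its value on complex conjugation is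
`+1` iff `τ̄₁`, `τ̄₂` have the SAME parity. [folklore] -/
theorem kronecker_transpose_JJ (A B : Matrix (Fin 2) (Fin 2) R) :
    (A ⊗ₖ B)ᵀ * ((J2 : Matrix (Fin 2) (Fin 2) R) ⊗ₖ J2) * (A ⊗ₖ B) =
      (A.det * B.det) • ((J2 : Matrix (Fin 2) (Fin 2) R) ⊗ₖ J2) := by
  have hT : (A ⊗ₖ B)ᵀ = Aᵀ ⊗ₖ Bᵀ := (Matrix.kroneckerMap_transpose (· * ·) A B).symm
  rw [hT, ← Matrix.mul_kronecker_mul, ← Matrix.mul_kronecker_mul, transpose_mul_J2_mul,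
    transpose_mul_J2_mul, Matrix.smul_kronecker, Matrix.kronecker_smul, smul_smul]

end Matrices

/-- **Rank-4 rung, the seed (signature; card K1 `TensorSeedFromDuality4`).**  `p ≥ 5`;
`ρ : Γ_ℚ → GL₄(ℚ̄_p)` whose residual representation `ρ̄` (a residual representation in the sense of
`IsResidualRepOf`, over `ℤ̄_p/𝔪`) is absolutely irreducible over `ℚ(ζ_p)` and preserves a SYMMETRIC
invertible form `S` up to a multiplier `μ` with `det ρ̄ = μ²` (the discriminant character is trivial:
`ρ̄` is `GSO₄`-valued) and `μ(c) = 1`, and some complex conjugation has trace `0` on `ρ`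
⇒ there are ODD `τ₁ τ₂ : Γ_ℚ → GL₂(ℚ̄_p)` and a character `η` with `tr ρ ≡ η · tr τ₁ · tr τ₂ (mod 𝔪)`.
(`GSO₄ ≅ (GL₂ × GL₂)/𝔾_m`, Tate lifting of the two projective factors, the sign law
`μ̄(c) = det τ̄₁(c) det τ̄₂(c)` of `kronecker_transpose_JJ`, `tr ρ(c) = 0` excluding (even, even), and
odd lifts by Serre's conjecture.)  [cite: KhareWintenberger2009, Thm 1.2] -/
def TensorSeedFromDuality4 : Prop :=
  ∀ (p : ℕ) [Fact p.Prime], 5 ≤ p → ∀ ρ : FramedGaloisRep ℚ (PadicAlgCl p) 4,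
    (ρ.restrictField (CyclotomicField p ℚ)).IsResiduallyAbsIrreducible →
    (∃ (τ : Field.absoluteGaloisGroup ℚ →* GL (Fin 4) (padicAlgClResidueField p))
       (S : Matrix (Fin 4) (Fin 4) (padicAlgClResidueField p))
       (μ : Field.absoluteGaloisGroup ℚ →* (padicAlgClResidueField p)ˣ)
       (φ : ℚ →+* ℝ) (c : Field.absoluteGaloisGroup ℚ),
       ρ.IsResidualRepOf (RingHom.id _) τ ∧ S.IsSymm ∧ IsUnit S.det ∧
       (∀ g, (τ g).valᵀ * S * (τ g).val = ((μ g : (padicAlgClResidueField p)ˣ) : padicAlgClResidueField p) • S) ∧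
       (∀ g, (τ g).val.det = ((μ g : (padicAlgClResidueField p)ˣ) : padicAlgClResidueField p) ^ 2) ∧
       IsComplexConjugation φ c ∧ μ c = 1 ∧ (ρ c).val.trace = 0) →
    ∃ (τ₁ τ₂ : FramedGaloisRep ℚ (PadicAlgCl p) 2) (η : FramedGaloisRep ℚ (PadicAlgCl p) 1),
      τ₁.IsOdd ∧ τ₂.IsOdd ∧
      ∀ σ, ‖(ρ σ).val.trace - (η σ).val 0 0 * (τ₁ σ).val.trace * (τ₂ σ).val.trace‖ < 1

/-- **Rank-4 rung, the engine (signature; card K2 `TensorLiftingGL4`).**  `p ≥ 17` (`p > n² = 16`,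
ACC+ Thm 6.1.1); `ρ : Γ_ℚ → GL₄(ℚ̄_p)` unramified a.e., crystalline at `p` with labelled weights
`{0,1,3,4}` (the GAP type `(1,1,0,1,1)`, weight 4), `ρ̄|ℚ(ζ_p)` absolutely irreducible, and
`tr ρ ≡ η · tr τ₁ · tr τ₂ (mod 𝔪)` for ODD `τ₁, τ₂ : Γ_ℚ → GL₂(ℚ̄_p)` ⇒ `ρ` is Satake–Frobenius
compatible a.e. with an L-algebraic cuspidal `π` on `GL₄(𝔸_ℚ)`, for every `ι`, `hcpt`.  (Residual
automorphy FOR FREE: `τ̄ᵢ` modular by Khare–Wintenberger, in Serre weights `2` and `4` prime to `p` by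
the Fontaine–Laffaille shape `{0,1} ⊗ {0,3}`, so `ρ̄ ≅ ρ̄_{f ⊠ g}` with `f ⊠ g` cuspidal on `GL₄`
(Ramakrishnan) of the SAME weight `{0,1,3,4}`; then ACC+ 6.1.1 over `ℚ` via an imaginary quadratic
base change.)  [cite: ACCGHLNSTT2023, Thm 6.1.1] [cite: Ramakrishnan2000, Thm M] -/
def TensorLiftingGL4 : Prop :=
  ∀ (p : ℕ) [Fact p.Prime], 17 ≤ p → ∀ ρ : FramedGaloisRep ℚ (PadicAlgCl p) 4,
    (∀ᶠ v : HeightOneSpectrum (𝓞 ℚ) in cofinite, ρ.IsUnramifiedAt v) →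
    (∀ (v : HeightOneSpectrum (𝓞 ℚ)) (hv : ((p : ℕ) : 𝓞 ℚ) ∈ v.asIdeal),
      let D := Literature.NumberTheory.PAdicHodge.fontainePstAdicCompletion v p hv
      D.IsCrystallineFramed (ρ.toLocal v) ∧ (letI := D.algebra;
        ∀ τ : v.adicCompletion ℚ →ₐ[ℚ_[p]] PadicAlgCl p,
          ρ.labelledHodgeTateWeightsAt v D.algebra D.𝔅 τ.toRingHom = {0, 1, 3, 4})) →
    (ρ.restrictField (CyclotomicField p ℚ)).IsResiduallyAbsIrreducible →
    (∃ (τ₁ τ₂ : FramedGaloisRep ℚ (PadicAlgCl p) 2) (η : FramedGaloisRep ℚ (PadicAlgCl p) 1),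
      τ₁.IsOdd ∧ τ₂.IsOdd ∧
      ∀ σ, ‖(ρ σ).val.trace - (η σ).val 0 0 * (τ₁ σ).val.trace * (τ₂ σ).val.trace‖ < 1) →
    ∀ (ι : PadicAlgCl p ≃+* ℂ) (hcpt : isCompact_glFiniteIntegralLevel 4 ℚ),
      ∃ π : CuspidalAutomorphicRepData 4 ℚ hcpt, π.1.IsLAlgebraic ∧
        ∀ᶠ v : HeightOneSpectrum (𝓞 ℚ) in cofinite, SatakeFrobCompatibleAt ι π.1 ρ v

/-- **Composition of the rank-4 rung (PROVED, pure logic)**: seed + engine give (B)-weak on the rank-4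
reflection sector of gap type. [folklore] -/
theorem weakB_rank4_of_rung (hS : TensorSeedFromDuality4) (hE : TensorLiftingGL4)
    (p : ℕ) [Fact p.Prime] (hp : 17 ≤ p) (ρ : FramedGaloisRep ℚ (PadicAlgCl p) 4)
    (hunr : ∀ᶠ v : HeightOneSpectrum (𝓞 ℚ) in cofinite, ρ.IsUnramifiedAt v)
    (hcrys : ∀ (v : HeightOneSpectrum (𝓞 ℚ)) (hv : ((p : ℕ) : 𝓞 ℚ) ∈ v.asIdeal),
      let D := Literature.NumberTheory.PAdicHodge.fontainePstAdicCompletion v p hv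
      D.IsCrystallineFramed (ρ.toLocal v) ∧ (letI := D.algebra;
        ∀ τ : v.adicCompletion ℚ →ₐ[ℚ_[p]] PadicAlgCl p,
          ρ.labelledHodgeTateWeightsAt v D.algebra D.𝔅 τ.toRingHom = {0, 1, 3, 4}))
    (hirr : (ρ.restrictField (CyclotomicField p ℚ)).IsResiduallyAbsIrreducible)
    (hdual : ∃ (τ : Field.absoluteGaloisGroup ℚ →* GL (Fin 4) (padicAlgClResidueField p))
       (S : Matrix (Fin 4) (Fin 4) (padicAlgClResidueField p))
       (μ : Field.absoluteGaloisGroup ℚ →* (padicAlgClResidueField p)ˣ)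
       (φ : ℚ →+* ℝ) (c : Field.absoluteGaloisGroup ℚ),
       ρ.IsResidualRepOf (RingHom.id _) τ ∧ S.IsSymm ∧ IsUnit S.det ∧
       (∀ g, (τ g).valᵀ * S * (τ g).val = ((μ g : (padicAlgClResidueField p)ˣ) : padicAlgClResidueField p) • S) ∧
       (∀ g, (τ g).val.det = ((μ g : (padicAlgClResidueField p)ˣ) : padicAlgClResidueField p) ^ 2) ∧
       IsComplexConjugation φ c ∧ μ c = 1 ∧ (ρ c).val.trace = 0)
    (ι : PadicAlgCl p ≃+* ℂ) (hcpt : isCompact_glFiniteIntegralLevel 4 ℚ) :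
    ∃ π : CuspidalAutomorphicRepData 4 ℚ hcpt, π.1.IsLAlgebraic ∧
      ∀ᶠ v : HeightOneSpectrum (𝓞 ℚ) in cofinite, SatakeFrobCompatibleAt ι π.1 ρ v :=
  hE p hp ρ hunr hcrys hirr (hS p (le_trans (by norm_num) hp) ρ hirr hdual) ι hcpt

end Summit.Langlands.Langlands.Cruxes.SectorComplement.Ideate16781R1K1

end
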